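import Summits.QuantumFields.BalabanUV.Gaps.D1SymmetryPencil
import Summits.QuantumFields.BalabanUV.Gaps.D1WardBorderWeightPolynomial

/-!
# `BalabanUV.Gaps.D1WardSolvableColourSet` — cell pub-balaban-gaps, row (D1), seat g1-p1: ON THE β-LEAD's PINNED FAMILY THE SET OF COLOUR TRIPLES ADMITTING A WARD-COMPATIBLE BORDER WEIGHT IS
# ALL OF ℝ³ OR A REAL ALGEBRAIC SET OF DEGREE ≤ 4 — at one level, and for all levels with ONE border weight; hypothesis-free off the pin

HONEST FRAMING (cell rule, page 1 of everything): [folklore] algebra BY NAME — GEN 16's pencil algebra (`Gaps/D1SymmetryPencil`: the Ward DEFECT `wardDefect`, `ward_pencil_exists_iff`,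
`ward_pencil_formula`, `ward_levels_exists_iff`), GEN 15's entrywise border-affinity and colour-freeness of the unit border tower (`D1WardPinsBorderWeight.flipK_TbalOf_JsBalAn1_border_affine`,
`unitBorder_colour_free`), GEN 12's entrywise five-node laws along affine lines and rays of colour triples (`D1PinnedColourLineReadings.TbalOf_JsBalAn1_line_nodes`,
`D1PinnedColourRayReadings.TbalOf_JsBalAn1_ray_nodes`), GEN 13's packaging lemma (`D1PinnedColourPolynomialAlgebra.exists_mvPolynomial_deg_le_four`).  The printed Ward identity (5.9)
[Balaban1987RG1 p. 293] is a PREDICATE (`PolarizationSign.WardTransversal`) on members of the cells' OWN pinned family `JsBalAn1(r; c⃗; cE₂; cB; T)` (the β-lead's candidate literal; which member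
is print's — (P6) — undecided); this file records what it demands of print's UNCOMPUTED colour triple `c⃗ = (cE, cVH, cΛ)` once the border weight `cB` is left free, AS ALGEBRA.  Nothing of
Bałaban's asserted; NO coefficient computed or signed; (D1) NOT discharged; 0∕4 row-D1 binders; NOT `BetaPertH`, NOT continuum, NOT Clay.
HONEST DEPENDENCY (b2b cell, verbatim): «continuum YM on T⁴ ⇐ BetaPertH ∧ nine spine estimates (0/9 proved); BetaPertH ⇐ (D1) ∧ (D4) ∧ CAP+tail; G-an2-4 gates asym, D1 and NE2/3/4.»

CONTENT (all [folklore]; no `def`, 0 sorry): §1 `wardDefect_wsum5` (the Ward defect of a five-term entrywise combination; finite sums, no summability); §2 (any `1 ≤ Lc`, box root, `cE₂`, `cB`,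
table, level) `wardDefect_flipK_JsBalAn1_line_nodes ∕ _ray_nodes` (the five- ∕ four-node laws pass to every Ward defect entry), **`wardDefect_eq_eval_mvPolynomial`** (EVERY Ward-defect entry
`c⃗ ↦ wardDefect (flipK T_j(c⃗; cB; T)) ν z` is `MvPolynomial.eval c⃗ Q` for ONE `Q` with `totalDegree ≤ 4`, `homogeneousComponent 1 = 0`, constant term = the colour-free member's entry),
`unitBorder_wardDefect_colour_free`; §3 **`wardBorderWeight_eq_eval_mvPolynomial_of_defect`** (given ONE entry where the unit border tower's Ward defect is nonzero, the Ward-compatible border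
weight is `eval c⃗ R`, `R` of total degree ≤ 4 without linear part — GEN 15's `wardBorderWeight_eq_eval_mvPolynomial` with the SHARPER handle: no zeroth moment, no summability),
**`exists_wardBorderWeight_iff_eval_eq_zero`** (with such an entry: for EVERY colour triple, «some border weight admits `hW` at level `j`» ⟺ a family of polynomials `M ν z` of total degree ≤ 4
without linear part ALL vanish at `c⃗`), **`wardSolvable_allColours_or_properAlgebraic`** (HYPOTHESIS-FREE: at each level EITHER every colour triple admits a Ward-compatible border weight OR the
colour triples that do are zeros of ONE NONZERO real polynomial of total degree ≤ 4 without linear part), and the same for the END's whole binder `hW : ∀ j, …` with ONE border weight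
(**`wardSolvableAllLevels_allColours_or_properAlgebraic`**); TOPOLOGICAL READING `wardSolvable[AllLevels]_allColours_or_fails_in_every_box` (all, or failure inside EVERY box with
infinite sides — `MvPolynomial.funext_set` — so the colour triples without a Ward-compatible border weight are then DENSE).

Provenance: cell pub-balaban-gaps, seat g1-p1 GEN 16 (prover-pub-balaban-gaps-g1-p1-g16-0), 2026-08-25; imports `Gaps/D1SymmetryPencil` (this seat) + `Gaps/D1WardBorderWeightPolynomial`
(p394413 ✓); no existing file touched.
-/

noncomputable section

open Literature.MathematicalPhysics.QuantumFieldTheory Balaban1983to89 Balaban1983to89.Beta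
open B6BondElimination (unitVec)
open OneStepResolventKernel (JetData)
open OneStepKernelFamily (TbalOf flipK)
open PolarizationSign (WardTransversal)
open AffineAveraging (box)
open Summit.QuantumFields.BalabanUV.Beta.MixedJetTablesPlug (JsBalAn1)
open Summit.QuantumFields.BalabanUV.Gaps.D1PinnedColourLineReadings (TbalOf_JsBalAn1_line_nodes)
open Summit.QuantumFields.BalabanUV.Gaps.D1PinnedColourRayReadings (TbalOf_JsBalAn1_ray_nodes)
open Summit.QuantumFields.BalabanUV.Gaps.D1PinnedColourPolynomialAlgebra (exists_mvPolynomial_deg_le_four)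
open Summit.QuantumFields.BalabanUV.Gaps.D1WardPinsBorderWeight (flipK_TbalOf_JsBalAn1_border_affine unitBorder_colour_free)
open Summit.QuantumFields.BalabanUV.Gaps.D1SymmetryPencil

namespace Summit.QuantumFields.BalabanUV.Gaps.D1WardSolvableColourSet

/-! ## §1 The Ward defect of a five-term entrywise combination -/

section Generic

variable {d : ℕ}

/-- [folklore] If `P = Σᵢ wᵢ·Pᵢ` entrywise (five kernels), then `wardDefect P ν z = Σᵢ wᵢ · wardDefect Pᵢ ν z` (finite sums only). -/
theorem wardDefect_wsum5 {P P₀ P₁ P₂ P₃ P₄ : B12Beta.Kernel d} (w₀ w₁ w₂ w₃ w₄ : ℝ)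
    (hP : ∀ a b z, P a b z = w₀ * P₀ a b z + w₁ * P₁ a b z + w₂ * P₂ a b z + w₃ * P₃ a b z + w₄ * P₄ a b z) (ν : Fin d) (z : Fin d → ℤ) :
    wardDefect P ν z = w₀ * wardDefect P₀ ν z + w₁ * wardDefect P₁ ν z + w₂ * wardDefect P₂ ν z + w₃ * wardDefect P₃ ν z + w₄ * wardDefect P₄ ν z := by
  unfold wardDefect
  rw [Finset.mul_sum, Finset.mul_sum, Finset.mul_sum, Finset.mul_sum, Finset.mul_sum, ← Finset.sum_add_distrib, ← Finset.sum_add_distrib, ← Finset.sum_add_distrib,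
    ← Finset.sum_add_distrib]
  exact Finset.sum_congr rfl fun μ _ => by rw [hP, hP]; ring

/-- [folklore] Bookkeeping: `totalDegree (C a * Q − C b * Q′) ≤ 4` and no linear part, from the same for `Q`, `Q′`. -/
theorem mvPolynomial_combination_deg_le_four {Q Q' : MvPolynomial (Fin 3) ℝ} (hQ4 : Q.totalDegree ≤ 4) (hQ1 : Q.homogeneousComponent 1 = 0) (hQ4' : Q'.totalDegree ≤ 4)
    (hQ1' : Q'.homogeneousComponent 1 = 0) (a b : ℝ) :
    (MvPolynomial.C a * Q - MvPolynomial.C b * Q').totalDegree ≤ 4 ∧ (MvPolynomial.C a * Q - MvPolynomial.C b * Q').homogeneousComponent 1 = 0 := by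
  refine ⟨(MvPolynomial.totalDegree_sub _ _).trans (max_le ?_ ?_), ?_⟩
  · exact (MvPolynomial.totalDegree_mul _ _).trans (by rw [MvPolynomial.totalDegree_C, zero_add]; exact hQ4)
  · exact (MvPolynomial.totalDegree_mul _ _).trans (by rw [MvPolynomial.totalDegree_C, zero_add]; exact hQ4')
  · rw [map_sub, MvPolynomial.homogeneousComponent_C_mul, MvPolynomial.homogeneousComponent_C_mul, hQ1, hQ1', mul_zero, mul_zero, sub_zero]

end Generic

/-! ## §2 The pinned family: every Ward-defect entry is ONE polynomial of total degree ≤ 4 without linear part in the colour triple -/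

section Pinned

variable {Lc : ℕ} [NeZero Lc] {r : Fin (3 + 1) → ℕ}

/-- [folklore] THE FIVE-NODE LAW ALONG AN AFFINE LINE OF COLOUR TRIPLES for every Ward-defect entry of the flipped step kernels (GEN 12's entrywise `TbalOf_JsBalAn1_line_nodes`). -/
theorem wardDefect_flipK_JsBalAn1_line_nodes (hLc : 1 ≤ Lc) (hr : r ∈ box (3 + 1) Lc) (cE₀ cVH₀ cΛ₀ cE₁ cVH₁ cΛ₁ cE₂ cB : ℝ) (T : Fin 4 → Fin 4 → Fin 4 → Fin 4 → ℝ) (j : ℕ)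
    (t s₀ s₁ s₂ s₃ s₄ w₀ w₁ w₂ w₃ w₄ : ℝ) (hm0 : w₀ + w₁ + w₂ + w₃ + w₄ = 1) (hm1 : w₀ * s₀ + w₁ * s₁ + w₂ * s₂ + w₃ * s₃ + w₄ * s₄ = t)
    (hm2 : w₀ * s₀ ^ 2 + w₁ * s₁ ^ 2 + w₂ * s₂ ^ 2 + w₃ * s₃ ^ 2 + w₄ * s₄ ^ 2 = t ^ 2)
    (hm3 : w₀ * s₀ ^ 3 + w₁ * s₁ ^ 3 + w₂ * s₂ ^ 3 + w₃ * s₃ ^ 3 + w₄ * s₄ ^ 3 = t ^ 3) (hm4 : w₀ * s₀ ^ 4 + w₁ * s₁ ^ 4 + w₂ * s₂ ^ 4 + w₃ * s₃ ^ 4 + w₄ * s₄ ^ 4 = t ^ 4)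
    (ν : Fin 4) (z : Fin 4 → ℤ) :
    wardDefect (flipK (TbalOf Lc (JsBalAn1 hLc hr (cE₀ + t * cE₁) (cVH₀ + t * cVH₁) (cΛ₀ + t * cΛ₁) cE₂ cB T) j)) ν z =
      w₀ * wardDefect (flipK (TbalOf Lc (JsBalAn1 hLc hr (cE₀ + s₀ * cE₁) (cVH₀ + s₀ * cVH₁) (cΛ₀ + s₀ * cΛ₁) cE₂ cB T) j)) ν z +
        w₁ * wardDefect (flipK (TbalOf Lc (JsBalAn1 hLc hr (cE₀ + s₁ * cE₁) (cVH₀ + s₁ * cVH₁) (cΛ₀ + s₁ * cΛ₁) cE₂ cB T) j)) ν z +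
        w₂ * wardDefect (flipK (TbalOf Lc (JsBalAn1 hLc hr (cE₀ + s₂ * cE₁) (cVH₀ + s₂ * cVH₁) (cΛ₀ + s₂ * cΛ₁) cE₂ cB T) j)) ν z +
        w₃ * wardDefect (flipK (TbalOf Lc (JsBalAn1 hLc hr (cE₀ + s₃ * cE₁) (cVH₀ + s₃ * cVH₁) (cΛ₀ + s₃ * cΛ₁) cE₂ cB T) j)) ν z +
        w₄ * wardDefect (flipK (TbalOf Lc (JsBalAn1 hLc hr (cE₀ + s₄ * cE₁) (cVH₀ + s₄ * cVH₁) (cΛ₀ + s₄ * cΛ₁) cE₂ cB T) j)) ν z :=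
  wardDefect_wsum5 w₀ w₁ w₂ w₃ w₄ (fun a b w => by
      simp only [OneStepKernelFamily.flipK_apply]
      exact TbalOf_JsBalAn1_line_nodes hLc hr cE₀ cVH₀ cΛ₀ cE₁ cVH₁ cΛ₁ cE₂ cB T j t s₀ s₁ s₂ s₃ s₄ w₀ w₁ w₂ w₃ w₄ hm0 hm1 hm2 hm3 hm4 a b (-w)) ν z

/-- [folklore] THE FOUR-NODE LAW ALONG A COLOUR RAY for every Ward-defect entry of the flipped step kernels (GEN 12's entrywise `TbalOf_JsBalAn1_ray_nodes`). -/
theorem wardDefect_flipK_JsBalAn1_ray_nodes (hLc : 1 ≤ Lc) (hr : r ∈ box (3 + 1) Lc) (cE cVH cΛ cE₂ cB : ℝ) (T : Fin 4 → Fin 4 → Fin 4 → Fin 4 → ℝ) (j : ℕ)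
    (t s₀ s₁ s₂ s₃ s₄ w₀ w₁ w₂ w₃ w₄ : ℝ) (hm0 : w₀ + w₁ + w₂ + w₃ + w₄ = 1) (hm2 : w₀ * s₀ ^ 2 + w₁ * s₁ ^ 2 + w₂ * s₂ ^ 2 + w₃ * s₃ ^ 2 + w₄ * s₄ ^ 2 = t ^ 2)
    (hm3 : w₀ * s₀ ^ 3 + w₁ * s₁ ^ 3 + w₂ * s₂ ^ 3 + w₃ * s₃ ^ 3 + w₄ * s₄ ^ 3 = t ^ 3) (hm4 : w₀ * s₀ ^ 4 + w₁ * s₁ ^ 4 + w₂ * s₂ ^ 4 + w₃ * s₃ ^ 4 + w₄ * s₄ ^ 4 = t ^ 4)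
    (ν : Fin 4) (z : Fin 4 → ℤ) :
    wardDefect (flipK (TbalOf Lc (JsBalAn1 hLc hr (t * cE) (t * cVH) (t * cΛ) cE₂ cB T) j)) ν z =
      w₀ * wardDefect (flipK (TbalOf Lc (JsBalAn1 hLc hr (s₀ * cE) (s₀ * cVH) (s₀ * cΛ) cE₂ cB T) j)) ν z +
        w₁ * wardDefect (flipK (TbalOf Lc (JsBalAn1 hLc hr (s₁ * cE) (s₁ * cVH) (s₁ * cΛ) cE₂ cB T) j)) ν z +
        w₂ * wardDefect (flipK (TbalOf Lc (JsBalAn1 hLc hr (s₂ * cE) (s₂ * cVH) (s₂ * cΛ) cE₂ cB T) j)) ν z +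
        w₃ * wardDefect (flipK (TbalOf Lc (JsBalAn1 hLc hr (s₃ * cE) (s₃ * cVH) (s₃ * cΛ) cE₂ cB T) j)) ν z +
        w₄ * wardDefect (flipK (TbalOf Lc (JsBalAn1 hLc hr (s₄ * cE) (s₄ * cVH) (s₄ * cΛ) cE₂ cB T) j)) ν z :=
  wardDefect_wsum5 w₀ w₁ w₂ w₃ w₄ (fun a b w => by
      simp only [OneStepKernelFamily.flipK_apply]
      exact TbalOf_JsBalAn1_ray_nodes hLc hr cE cVH cΛ cE₂ cB T j t s₀ s₁ s₂ s₃ s₄ w₀ w₁ w₂ w₃ w₄ hm0 hm2 hm3 hm4 a b (-w)) ν z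

/-- [folklore] **EVERY WARD-DEFECT ENTRY OF A STEP KERNEL IS ONE REAL POLYNOMIAL OF TOTAL DEGREE ≤ 4 WITHOUT LINEAR PART IN THE COLOUR TRIPLE** (any `1 ≤ Lc`, `cE₂`, `cB`, table, root,
level, entry `(ν, z)`): `wardDefect (flipK T_j(c⃗; cB; T)) ν z = MvPolynomial.eval c⃗ Q`, `Q.totalDegree ≤ 4`, `Q.homogeneousComponent 1 = 0`, `Q.coeff 0` = the colour-free member's entry. -/
theorem wardDefect_eq_eval_mvPolynomial (hLc : 1 ≤ Lc) (hr : r ∈ box (3 + 1) Lc) (cE₂ cB : ℝ) (T : Fin 4 → Fin 4 → Fin 4 → Fin 4 → ℝ) (j : ℕ) (ν : Fin 4) (z : Fin 4 → ℤ) :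
    ∃ Q : MvPolynomial (Fin 3) ℝ, Q.totalDegree ≤ 4 ∧ Q.homogeneousComponent 1 = 0 ∧
      Q.coeff 0 = wardDefect (flipK (TbalOf Lc (JsBalAn1 hLc hr 0 0 0 cE₂ cB T) j)) ν z ∧
      ∀ cE cVH cΛ : ℝ, wardDefect (flipK (TbalOf Lc (JsBalAn1 hLc hr cE cVH cΛ cE₂ cB T) j)) ν z = MvPolynomial.eval ![cE, cVH, cΛ] Q := by
  refine exists_mvPolynomial_deg_le_four (fun cE cVH cΛ => wardDefect (flipK (TbalOf Lc (JsBalAn1 hLc hr cE cVH cΛ cE₂ cB T) j)) ν z)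
    (fun cE₀ cVH₀ cΛ₀ cE₁ cVH₁ cΛ₁ t => ?_) (fun cE cVH cΛ t => ?_)
  · have h := wardDefect_flipK_JsBalAn1_line_nodes hLc hr cE₀ cVH₀ cΛ₀ cE₁ cVH₁ cΛ₁ cE₂ cB T j t 0 1 2 3 4 ((t - 1) * (t - 2) * (t - 3) * (t - 4) / 24)
      (-(t * (t - 2) * (t - 3) * (t - 4) / 6)) (t * (t - 1) * (t - 3) * (t - 4) / 4) (-(t * (t - 1) * (t - 2) * (t - 4) / 6)) (t * (t - 1) * (t - 2) * (t - 3) / 24)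
      (by ring) (by ring) (by ring) (by ring) (by ring) ν z
    simp only [zero_mul, one_mul, add_zero] at h
    exact h
  · have h := wardDefect_flipK_JsBalAn1_ray_nodes hLc hr cE cVH cΛ cE₂ cB T j t 0 1 2 3 0
      (1 - t ^ 2 * (t - 2) * (t - 3) / 2 + t ^ 2 * (t - 1) * (t - 3) / 4 - t ^ 2 * (t - 1) * (t - 2) / 18) (t ^ 2 * (t - 2) * (t - 3) / 2)
      (-(t ^ 2 * (t - 1) * (t - 3) / 4)) (t ^ 2 * (t - 1) * (t - 2) / 18) 0 (by ring) (by ring) (by ring) (by ring) ν z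
    simp only [zero_mul, one_mul, add_zero] at h
    exact h

/-- [folklore] The unit border tower's Ward defect is COLOUR-FREE (GEN 15's entrywise `unitBorder_colour_free`). -/
theorem unitBorder_wardDefect_colour_free (hLc : 1 ≤ Lc) (hr : r ∈ box (3 + 1) Lc) (cE cVH cΛ cE' cVH' cΛ' cE₂ : ℝ) (T : Fin 4 → Fin 4 → Fin 4 → Fin 4 → ℝ) (j : ℕ) (ν : Fin 4)
    (z : Fin 4 → ℤ) :
    wardDefect (fun a b w => flipK (TbalOf Lc (JsBalAn1 hLc hr cE cVH cΛ cE₂ 1 T) j) a b w - flipK (TbalOf Lc (JsBalAn1 hLc hr cE cVH cΛ cE₂ 0 T) j) a b w) ν z =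
      wardDefect (fun a b w => flipK (TbalOf Lc (JsBalAn1 hLc hr cE' cVH' cΛ' cE₂ 1 T) j) a b w - flipK (TbalOf Lc (JsBalAn1 hLc hr cE' cVH' cΛ' cE₂ 0 T) j) a b w) ν z := by
  unfold wardDefect
  refine Finset.sum_congr rfl fun μ _ => ?_
  simp only [OneStepKernelFamily.flipK_apply]
  rw [unitBorder_colour_free hLc hr cE cVH cΛ cE' cVH' cΛ' cE₂ T j μ ν (-(z - unitVec μ)), unitBorder_colour_free hLc hr cE cVH cΛ cE' cVH' cΛ' cE₂ T j μ ν (-z)]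

/-! ## §3 The Ward-compatible border weight as a polynomial; the Ward-solvable colour set is algebraic of degree ≤ 4, or everything -/

/-- [folklore] **THE WARD-COMPATIBLE BORDER WEIGHT IS ONE POLYNOMIAL OF TOTAL DEGREE ≤ 4 WITHOUT LINEAR PART IN THE COLOUR TRIPLE — from ONE nonzero Ward-defect entry of the unit border
tower** (sharper handle than GEN 15's `wardBorderWeight_eq_eval_mvPolynomial`: no zeroth moment, no summability).  Fix a level `j`, root, `cE₂`, table `T`, and an entry `(ν₀, z₀)` at which
`u := wardDefect (flipK T_j(c⃗₀;1;T) − flipK T_j(c⃗₀;0;T)) ν₀ z₀ ≠ 0` (colour-free).  Then ONE `R`, `R.totalDegree ≤ 4`, `R.homogeneousComponent 1 = 0`, gives, for EVERY colour triple and border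
weight, `hW` at level `j` ⟹ `cB = MvPolynomial.eval c⃗ R`. -/
theorem wardBorderWeight_eq_eval_mvPolynomial_of_defect (hLc : 1 ≤ Lc) (hr : r ∈ box (3 + 1) Lc) (cE₀ cVH₀ cΛ₀ cE₂ : ℝ) (T : Fin 4 → Fin 4 → Fin 4 → Fin 4 → ℝ) (j : ℕ) {ν₀ : Fin 4}
    {z₀ : Fin 4 → ℤ}
    (hU : wardDefect (fun a b w => flipK (TbalOf Lc (JsBalAn1 hLc hr cE₀ cVH₀ cΛ₀ cE₂ 1 T) j) a b w - flipK (TbalOf Lc (JsBalAn1 hLc hr cE₀ cVH₀ cΛ₀ cE₂ 0 T) j) a b w) ν₀ z₀ ≠ 0) :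
    ∃ R : MvPolynomial (Fin 3) ℝ, R.totalDegree ≤ 4 ∧ R.homogeneousComponent 1 = 0 ∧
      ∀ cE cVH cΛ cB : ℝ, WardTransversal (flipK (TbalOf Lc (JsBalAn1 hLc hr cE cVH cΛ cE₂ cB T) j)) → cB = MvPolynomial.eval ![cE, cVH, cΛ] R := by
  set u := wardDefect (fun a b w => flipK (TbalOf Lc (JsBalAn1 hLc hr cE₀ cVH₀ cΛ₀ cE₂ 1 T) j) a b w - flipK (TbalOf Lc (JsBalAn1 hLc hr cE₀ cVH₀ cΛ₀ cE₂ 0 T) j) a b w) ν₀ z₀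
    with hu
  obtain ⟨Q, hQ4, hQ1, -, hQ⟩ := wardDefect_eq_eval_mvPolynomial hLc hr cE₂ 0 T j ν₀ z₀
  refine ⟨MvPolynomial.C (-u⁻¹) * Q, ?_, ?_, fun cE cVH cΛ cB hW => ?_⟩
  · exact (MvPolynomial.totalDegree_mul _ _).trans (by rw [MvPolynomial.totalDegree_C, zero_add]; exact hQ4)
  · rw [MvPolynomial.homogeneousComponent_C_mul, hQ1, mul_zero]
  · have hU' : wardDefect (fun a b w => flipK (TbalOf Lc (JsBalAn1 hLc hr cE cVH cΛ cE₂ 1 T) j) a b w - flipK (TbalOf Lc (JsBalAn1 hLc hr cE cVH cΛ cE₂ 0 T) j) a b w) ν₀ z₀ ≠ 0 := by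
      rwa [unitBorder_wardDefect_colour_free hLc hr cE cVH cΛ cE₀ cVH₀ cΛ₀ cE₂ T j ν₀ z₀]
    have hw := ward_pencil_formula (P := fun c => flipK (TbalOf Lc (JsBalAn1 hLc hr cE cVH cΛ cE₂ c T) j))
      (fun c a b w => flipK_TbalOf_JsBalAn1_border_affine hLc hr cE cVH cΛ cE₂ c T j a b w) hU' hW
    rw [unitBorder_wardDefect_colour_free hLc hr cE cVH cΛ cE₀ cVH₀ cΛ₀ cE₂ T j ν₀ z₀, ← hu, hQ cE cVH cΛ] at hw
    rw [hw, map_mul, MvPolynomial.eval_C]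
    field_simp

/-- [folklore] **«SOME BORDER WEIGHT ADMITS `hW` AT LEVEL `j`» IS A SYSTEM OF POLYNOMIAL EQUATIONS OF DEGREE ≤ 4 IN THE COLOUR TRIPLE.**  With one entry `(ν₀, z₀)` of nonzero unit-border Ward
defect (at any reference colour triple — it is colour-free): a family `M ν z` of real polynomials in three variables, each of total degree ≤ 4 without linear part, such that for EVERY colour
triple `c⃗`: `(∃ cB, hW at level j for (c⃗; cB; T)) ↔ ∀ ν z, MvPolynomial.eval c⃗ (M ν z) = 0` (the minors of `Gaps/D1SymmetryPencil.ward_pencil_exists_iff` against the pivot, made polynomial). -/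
theorem exists_wardBorderWeight_iff_eval_eq_zero (hLc : 1 ≤ Lc) (hr : r ∈ box (3 + 1) Lc) (cE₀ cVH₀ cΛ₀ cE₂ : ℝ) (T : Fin 4 → Fin 4 → Fin 4 → Fin 4 → ℝ) (j : ℕ) {ν₀ : Fin 4}
    {z₀ : Fin 4 → ℤ}
    (hU : wardDefect (fun a b w => flipK (TbalOf Lc (JsBalAn1 hLc hr cE₀ cVH₀ cΛ₀ cE₂ 1 T) j) a b w - flipK (TbalOf Lc (JsBalAn1 hLc hr cE₀ cVH₀ cΛ₀ cE₂ 0 T) j) a b w) ν₀ z₀ ≠ 0) :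
    ∃ M : Fin 4 → (Fin 4 → ℤ) → MvPolynomial (Fin 3) ℝ, (∀ ν z, (M ν z).totalDegree ≤ 4 ∧ (M ν z).homogeneousComponent 1 = 0) ∧
      ∀ cE cVH cΛ : ℝ, (∃ cB : ℝ, WardTransversal (flipK (TbalOf Lc (JsBalAn1 hLc hr cE cVH cΛ cE₂ cB T) j))) ↔ ∀ ν z, MvPolynomial.eval ![cE, cVH, cΛ] (M ν z) = 0 := by
  have hQ := fun ν z => wardDefect_eq_eval_mvPolynomial hLc hr cE₂ 0 T j ν z
  choose Q hQ4 hQ1 _hQ0 hQ using hQ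
  set u : Fin 4 → (Fin 4 → ℤ) → ℝ := fun ν z =>
    wardDefect (fun a b w => flipK (TbalOf Lc (JsBalAn1 hLc hr cE₀ cVH₀ cΛ₀ cE₂ 1 T) j) a b w - flipK (TbalOf Lc (JsBalAn1 hLc hr cE₀ cVH₀ cΛ₀ cE₂ 0 T) j) a b w) ν z with hu
  refine ⟨fun ν z => MvPolynomial.C (u ν₀ z₀) * Q ν z - MvPolynomial.C (u ν z) * Q ν₀ z₀, fun ν z => mvPolynomial_combination_deg_le_four (hQ4 ν z) (hQ1 ν z) (hQ4 ν₀ z₀) (hQ1 ν₀ z₀) _ _,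
    fun cE cVH cΛ => ?_⟩
  have hUc : ∀ ν z, wardDefect (fun a b w => flipK (TbalOf Lc (JsBalAn1 hLc hr cE cVH cΛ cE₂ 1 T) j) a b w - flipK (TbalOf Lc (JsBalAn1 hLc hr cE cVH cΛ cE₂ 0 T) j) a b w) ν z = u ν z :=
    fun ν z => unitBorder_wardDefect_colour_free hLc hr cE cVH cΛ cE₀ cVH₀ cΛ₀ cE₂ T j ν z
  have hU' : wardDefect (fun a b w => flipK (TbalOf Lc (JsBalAn1 hLc hr cE cVH cΛ cE₂ 1 T) j) a b w - flipK (TbalOf Lc (JsBalAn1 hLc hr cE cVH cΛ cE₂ 0 T) j) a b w) ν₀ z₀ ≠ 0 := by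
    rw [hUc]; exact hU
  rw [ward_pencil_exists_iff (P := fun c => flipK (TbalOf Lc (JsBalAn1 hLc hr cE cVH cΛ cE₂ c T) j)) (fun c a b w => flipK_TbalOf_JsBalAn1_border_affine hLc hr cE cVH cΛ cE₂ c T j a b w) hU']
  refine forall₂_congr fun ν z => ?_
  simp only [hUc, hQ _ _ cE cVH cΛ, map_sub, map_mul, MvPolynomial.eval_C]
  constructor
  · intro h; linear_combination h
  · intro h; linear_combination h

/-- [folklore] **HYPOTHESIS-FREE DICHOTOMY AT ONE LEVEL: EITHER EVERY COLOUR TRIPLE ADMITS A WARD-COMPATIBLE BORDER WEIGHT, OR THOSE THAT DO LIE ON A REAL ALGEBRAIC HYPERSURFACE OF DEGREE ≤ 4**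
(any `1 ≤ Lc`, box root, `cE₂`, table, level): `(∀ c⃗, ∃ cB, hW_j(c⃗; cB; T)) ∨ ∃ M ≠ 0, M.totalDegree ≤ 4, M.homogeneousComponent 1 = 0, ∀ c⃗, (∃ cB, hW_j) → eval c⃗ M = 0`.  (If the unit
border tower is Ward-transversal at level `j`, solvability means transversality of the member `cB = 0`, whose defect entries are the polynomials of §2; if not, §3's minors.) -/
theorem wardSolvable_allColours_or_properAlgebraic (hLc : 1 ≤ Lc) (hr : r ∈ box (3 + 1) Lc) (cE₂ : ℝ) (T : Fin 4 → Fin 4 → Fin 4 → Fin 4 → ℝ) (j : ℕ) :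
    (∀ cE cVH cΛ : ℝ, ∃ cB : ℝ, WardTransversal (flipK (TbalOf Lc (JsBalAn1 hLc hr cE cVH cΛ cE₂ cB T) j))) ∨
      ∃ M : MvPolynomial (Fin 3) ℝ, M ≠ 0 ∧ M.totalDegree ≤ 4 ∧ M.homogeneousComponent 1 = 0 ∧
        ∀ cE cVH cΛ : ℝ, (∃ cB : ℝ, WardTransversal (flipK (TbalOf Lc (JsBalAn1 hLc hr cE cVH cΛ cE₂ cB T) j))) → MvPolynomial.eval ![cE, cVH, cΛ] M = 0 := by
  by_cases hUT : WardTransversal (fun a b w => flipK (TbalOf Lc (JsBalAn1 hLc hr 0 0 0 cE₂ 1 T) j) a b w - flipK (TbalOf Lc (JsBalAn1 hLc hr 0 0 0 cE₂ 0 T) j) a b w)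
  · -- the unit border tower is transversal: solvability ⟺ transversality of the member `cB = 0`
    have hQ := fun ν z => wardDefect_eq_eval_mvPolynomial hLc hr cE₂ 0 T j ν z
    choose Q hQ4 hQ1 _hQ0 hQ using hQ
    have key : ∀ cE cVH cΛ : ℝ, (∃ cB : ℝ, WardTransversal (flipK (TbalOf Lc (JsBalAn1 hLc hr cE cVH cΛ cE₂ cB T) j))) ↔ ∀ ν z, MvPolynomial.eval ![cE, cVH, cΛ] (Q ν z) = 0 := by
      intro cE cVH cΛ
      have hUc : WardTransversal (fun a b w => flipK (TbalOf Lc (JsBalAn1 hLc hr cE cVH cΛ cE₂ 1 T) j) a b w - flipK (TbalOf Lc (JsBalAn1 hLc hr cE cVH cΛ cE₂ 0 T) j) a b w) := by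
        rw [wardTransversal_iff] at hUT ⊢
        intro ν z
        rw [unitBorder_wardDefect_colour_free hLc hr cE cVH cΛ 0 0 0 cE₂ T j ν z]
        exact hUT ν z
      have hP := fun c a b w => flipK_TbalOf_JsBalAn1_border_affine hLc hr cE cVH cΛ cE₂ c T j a b w
      have hall : ∀ cB : ℝ, WardTransversal (flipK (TbalOf Lc (JsBalAn1 hLc hr cE cVH cΛ cE₂ cB T) j)) ↔ WardTransversal (flipK (TbalOf Lc (JsBalAn1 hLc hr cE cVH cΛ cE₂ 0 T) j)) := by
        intro cB
        rw [wardTransversal_iff, wardTransversal_iff]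
        refine forall₂_congr fun ν z => ?_
        rw [wardDefect_pencil (hP cB) ν z, (wardTransversal_iff _).1 hUc ν z, mul_zero, add_zero]
      constructor
      · rintro ⟨cB, hcB⟩ ν z
        rw [← hQ ν z cE cVH cΛ]
        exact ((wardTransversal_iff _).1 ((hall cB).1 hcB)) ν z
      · intro h
        exact ⟨0, (wardTransversal_iff _).2 fun ν z => by rw [hQ ν z cE cVH cΛ]; exact h ν z⟩
    by_cases hzero : ∀ ν z, Q ν z = 0
    · exact Or.inl fun cE cVH cΛ => (key cE cVH cΛ).2 fun ν z => by rw [hzero ν z, map_zero]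
    · obtain ⟨ν, z, hne⟩ : ∃ ν z, Q ν z ≠ 0 := by
        by_contra hcon
        exact hzero fun ν z => by by_contra h; exact hcon ⟨ν, z, h⟩
      exact Or.inr ⟨Q ν z, hne, hQ4 ν z, hQ1 ν z, fun cE cVH cΛ h => ((key cE cVH cΛ).1 h) ν z⟩
  · -- the unit border tower is NOT transversal: a pivot entry exists, §3's minors
    obtain ⟨ν₀, z₀, hU⟩ : ∃ ν₀ z₀, wardDefect (fun a b w => flipK (TbalOf Lc (JsBalAn1 hLc hr 0 0 0 cE₂ 1 T) j) a b w - flipK (TbalOf Lc (JsBalAn1 hLc hr 0 0 0 cE₂ 0 T) j) a b w) ν₀ z₀ ≠ 0 := by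
      by_contra hcon
      exact hUT ((wardTransversal_iff _).2 fun ν z => by by_contra h; exact hcon ⟨ν, z, h⟩)
    obtain ⟨M, hM, key⟩ := exists_wardBorderWeight_iff_eval_eq_zero hLc hr 0 0 0 cE₂ T j hU
    by_cases hzero : ∀ ν z, M ν z = 0
    · exact Or.inl fun cE cVH cΛ => (key cE cVH cΛ).2 fun ν z => by rw [hzero ν z, map_zero]
    · obtain ⟨ν, z, hne⟩ : ∃ ν z, M ν z ≠ 0 := by
        by_contra hcon
        exact hzero fun ν z => by by_contra h; exact hcon ⟨ν, z, h⟩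
      exact Or.inr ⟨M ν z, hne, (hM ν z).1, (hM ν z).2, fun cE cVH cΛ h => ((key cE cVH cΛ).1 h) ν z⟩

/-- [folklore] **THE SAME FOR THE END's WHOLE BINDER `hW : ∀ j, WardTransversal (flipK (TbalOf … j))` WITH ONE BORDER WEIGHT**: EITHER every colour triple admits ONE border weight that is
Ward-compatible at EVERY level, OR the colour triples that do are zeros of ONE NONZERO real polynomial of total degree ≤ 4 without linear part (cross-level minors of
`Gaps/D1SymmetryPencil.ward_levels_exists_iff`, made polynomial; hypothesis-free). -/
theorem wardSolvableAllLevels_allColours_or_properAlgebraic (hLc : 1 ≤ Lc) (hr : r ∈ box (3 + 1) Lc) (cE₂ : ℝ) (T : Fin 4 → Fin 4 → Fin 4 → Fin 4 → ℝ) :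
    (∀ cE cVH cΛ : ℝ, ∃ cB : ℝ, ∀ j, WardTransversal (flipK (TbalOf Lc (JsBalAn1 hLc hr cE cVH cΛ cE₂ cB T) j))) ∨
      ∃ M : MvPolynomial (Fin 3) ℝ, M ≠ 0 ∧ M.totalDegree ≤ 4 ∧ M.homogeneousComponent 1 = 0 ∧
        ∀ cE cVH cΛ : ℝ, (∃ cB : ℝ, ∀ j, WardTransversal (flipK (TbalOf Lc (JsBalAn1 hLc hr cE cVH cΛ cE₂ cB T) j))) → MvPolynomial.eval ![cE, cVH, cΛ] M = 0 := by
  have hQ := fun j ν z => wardDefect_eq_eval_mvPolynomial hLc hr cE₂ 0 T j ν z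
  choose Q hQ4 hQ1 _hQ0 hQ using hQ
  -- the colour-free unit border defects
  set u : ℕ → Fin 4 → (Fin 4 → ℤ) → ℝ := fun j ν z =>
    wardDefect (fun a b w => flipK (TbalOf Lc (JsBalAn1 hLc hr 0 0 0 cE₂ 1 T) j) a b w - flipK (TbalOf Lc (JsBalAn1 hLc hr 0 0 0 cE₂ 0 T) j) a b w) ν z with hu
  have hUc : ∀ cE cVH cΛ j ν z, wardDefect (fun a b w => flipK (TbalOf Lc (JsBalAn1 hLc hr cE cVH cΛ cE₂ 1 T) j) a b w - flipK (TbalOf Lc (JsBalAn1 hLc hr cE cVH cΛ cE₂ 0 T) j) a b w) ν z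
      = u j ν z := fun cE cVH cΛ j ν z => unitBorder_wardDefect_colour_free hLc hr cE cVH cΛ 0 0 0 cE₂ T j ν z
  have hP : ∀ cE cVH cΛ j c a b w, flipK (TbalOf Lc (JsBalAn1 hLc hr cE cVH cΛ cE₂ c T) j) a b w = flipK (TbalOf Lc (JsBalAn1 hLc hr cE cVH cΛ cE₂ 0 T) j) a b w +
      c * (fun a' b' w' => flipK (TbalOf Lc (JsBalAn1 hLc hr cE cVH cΛ cE₂ 1 T) j) a' b' w' - flipK (TbalOf Lc (JsBalAn1 hLc hr cE cVH cΛ cE₂ 0 T) j) a' b' w') a b w :=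
    fun cE cVH cΛ j c a b w => flipK_TbalOf_JsBalAn1_border_affine hLc hr cE cVH cΛ cE₂ c T j a b w
  by_cases hUT : ∀ j ν z, u j ν z = 0
  · -- every unit border tower transversal: solvability ⟺ the member `cB = 0` is transversal at every level
    have key : ∀ cE cVH cΛ : ℝ, (∃ cB : ℝ, ∀ j, WardTransversal (flipK (TbalOf Lc (JsBalAn1 hLc hr cE cVH cΛ cE₂ cB T) j))) ↔
        ∀ j ν z, MvPolynomial.eval ![cE, cVH, cΛ] (Q j ν z) = 0 := by
      intro cE cVH cΛ
      have hall : ∀ (cB : ℝ) j, WardTransversal (flipK (TbalOf Lc (JsBalAn1 hLc hr cE cVH cΛ cE₂ cB T) j)) ↔ ∀ ν z, MvPolynomial.eval ![cE, cVH, cΛ] (Q j ν z) = 0 := by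
        intro cB j
        rw [wardTransversal_iff]
        refine forall₂_congr fun ν z => ?_
        rw [wardDefect_pencil (hP cE cVH cΛ j cB) ν z, hUc, hUT j ν z, mul_zero, add_zero, hQ j ν z cE cVH cΛ]
      constructor
      · rintro ⟨cB, hcB⟩ j
        exact (hall cB j).1 (hcB j)
      · intro h
        exact ⟨0, fun j => (hall 0 j).2 (h j)⟩
    by_cases hzero : ∀ j ν z, Q j ν z = 0
    · exact Or.inl fun cE cVH cΛ => (key cE cVH cΛ).2 fun j ν z => by rw [hzero j ν z, map_zero]
    · obtain ⟨j, ν, z, hne⟩ : ∃ j ν z, Q j ν z ≠ 0 := by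
        by_contra hcon
        exact hzero fun j ν z => by by_contra h; exact hcon ⟨j, ν, z, h⟩
      exact Or.inr ⟨Q j ν z, hne, hQ4 j ν z, hQ1 j ν z, fun cE cVH cΛ h => ((key cE cVH cΛ).1 h) j ν z⟩
  · -- a pivot `(j₀, ν₀, z₀)` with nonzero unit-border defect: cross-level minors
    obtain ⟨j₀, ν₀, z₀, hU⟩ : ∃ j₀ ν₀ z₀, u j₀ ν₀ z₀ ≠ 0 := by
      by_contra hcon
      exact hUT fun j ν z => by by_contra h; exact hcon ⟨j, ν, z, h⟩
    set M : ℕ → Fin 4 → (Fin 4 → ℤ) → MvPolynomial (Fin 3) ℝ := fun j ν z => MvPolynomial.C (u j₀ ν₀ z₀) * Q j ν z - MvPolynomial.C (u j ν z) * Q j₀ ν₀ z₀ with hM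
    have key : ∀ cE cVH cΛ : ℝ, (∃ cB : ℝ, ∀ j, WardTransversal (flipK (TbalOf Lc (JsBalAn1 hLc hr cE cVH cΛ cE₂ cB T) j))) ↔
        ∀ j ν z, MvPolynomial.eval ![cE, cVH, cΛ] (M j ν z) = 0 := by
      intro cE cVH cΛ
      have hU' : wardDefect (fun a b w => flipK (TbalOf Lc (JsBalAn1 hLc hr cE cVH cΛ cE₂ 1 T) j₀) a b w - flipK (TbalOf Lc (JsBalAn1 hLc hr cE cVH cΛ cE₂ 0 T) j₀) a b w) ν₀ z₀ ≠ 0 := by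
        rw [hUc]; exact hU
      rw [ward_levels_exists_iff (P := fun j c => flipK (TbalOf Lc (JsBalAn1 hLc hr cE cVH cΛ cE₂ c T) j))
        (U := fun j => fun a b w => flipK (TbalOf Lc (JsBalAn1 hLc hr cE cVH cΛ cE₂ 1 T) j) a b w - flipK (TbalOf Lc (JsBalAn1 hLc hr cE cVH cΛ cE₂ 0 T) j) a b w)
        (hP cE cVH cΛ) hU']
      refine forall₃_congr fun j ν z => ?_
      simp only [hUc, hQ _ _ _ cE cVH cΛ, hM, map_sub, map_mul, MvPolynomial.eval_C]
      constructor
      · intro h; linear_combination h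
      · intro h; linear_combination h
    by_cases hzero : ∀ j ν z, M j ν z = 0
    · exact Or.inl fun cE cVH cΛ => (key cE cVH cΛ).2 fun j ν z => by rw [hzero j ν z, map_zero]
    · obtain ⟨j, ν, z, hne⟩ : ∃ j ν z, M j ν z ≠ 0 := by
        by_contra hcon
        exact hzero fun j ν z => by by_contra h; exact hcon ⟨j, ν, z, h⟩
      exact Or.inr ⟨M j ν z, hne, (mvPolynomial_combination_deg_le_four (hQ4 j ν z) (hQ1 j ν z) (hQ4 j₀ ν₀ z₀) (hQ1 j₀ ν₀ z₀) _ _).1,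
        (mvPolynomial_combination_deg_le_four (hQ4 j ν z) (hQ1 j ν z) (hQ4 j₀ ν₀ z₀) (hQ1 j₀ ν₀ z₀) _ _).2, fun cE cVH cΛ h => ((key cE cVH cΛ).1 h) j ν z⟩

/-- [folklore] **TOPOLOGICAL READING: ALL, OR FAILURE IN EVERY BOX WITH INFINITE SIDES** (in particular in every open box — the colour triples WITHOUT a Ward-compatible border weight are then
DENSE): a nonzero real polynomial cannot vanish on a box with infinite sides (`MvPolynomial.funext_set`). -/
theorem wardSolvable_allColours_or_fails_in_every_box (hLc : 1 ≤ Lc) (hr : r ∈ box (3 + 1) Lc) (cE₂ : ℝ) (T : Fin 4 → Fin 4 → Fin 4 → Fin 4 → ℝ) (j : ℕ)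
    (s : Fin 3 → Set ℝ) (hs : ∀ i, (s i).Infinite) :
    (∀ cE cVH cΛ : ℝ, ∃ cB : ℝ, WardTransversal (flipK (TbalOf Lc (JsBalAn1 hLc hr cE cVH cΛ cE₂ cB T) j))) ∨
      ∃ x : Fin 3 → ℝ, x ∈ Set.pi Set.univ s ∧ ¬ ∃ cB : ℝ, WardTransversal (flipK (TbalOf Lc (JsBalAn1 hLc hr (x 0) (x 1) (x 2) cE₂ cB T) j)) := by
  rcases wardSolvable_allColours_or_properAlgebraic hLc hr cE₂ T j with h | ⟨M, hM0, -, -, hM⟩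
  · exact Or.inl h
  · refine Or.inr ?_
    by_contra hcon
    apply hM0
    refine MvPolynomial.funext_set s hs fun x hx => ?_
    rw [map_zero]
    have hsol : ∃ cB : ℝ, WardTransversal (flipK (TbalOf Lc (JsBalAn1 hLc hr (x 0) (x 1) (x 2) cE₂ cB T) j)) := by
      by_contra h
      exact hcon ⟨x, hx, h⟩
    have hx3 : (![x 0, x 1, x 2] : Fin 3 → ℝ) = x := by
      funext i; fin_cases i <;> rfl
    have h3 := hM (x 0) (x 1) (x 2) hsol
    rwa [hx3] at h3

/-- [folklore] The same for the END's whole binder `hW : ∀ j` with ONE border weight. -/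
theorem wardSolvableAllLevels_allColours_or_fails_in_every_box (hLc : 1 ≤ Lc) (hr : r ∈ box (3 + 1) Lc) (cE₂ : ℝ) (T : Fin 4 → Fin 4 → Fin 4 → Fin 4 → ℝ)
    (s : Fin 3 → Set ℝ) (hs : ∀ i, (s i).Infinite) :
    (∀ cE cVH cΛ : ℝ, ∃ cB : ℝ, ∀ j, WardTransversal (flipK (TbalOf Lc (JsBalAn1 hLc hr cE cVH cΛ cE₂ cB T) j))) ∨
      ∃ x : Fin 3 → ℝ, x ∈ Set.pi Set.univ s ∧ ¬ ∃ cB : ℝ, ∀ j, WardTransversal (flipK (TbalOf Lc (JsBalAn1 hLc hr (x 0) (x 1) (x 2) cE₂ cB T) j)) := by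
  rcases wardSolvableAllLevels_allColours_or_properAlgebraic hLc hr cE₂ T with h | ⟨M, hM0, -, -, hM⟩
  · exact Or.inl h
  · refine Or.inr ?_
    by_contra hcon
    apply hM0
    refine MvPolynomial.funext_set s hs fun x hx => ?_
    rw [map_zero]
    have hsol : ∃ cB : ℝ, ∀ j, WardTransversal (flipK (TbalOf Lc (JsBalAn1 hLc hr (x 0) (x 1) (x 2) cE₂ cB T) j)) := by
      by_contra h
      exact hcon ⟨x, hx, h⟩
    have hx3 : (![x 0, x 1, x 2] : Fin 3 → ℝ) = x := by
      funext i; fin_cases i <;> rfl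
    have h3 := hM (x 0) (x 1) (x 2) hsol
    rwa [hx3] at h3

end Pinned

end Summit.QuantumFields.BalabanUV.Gaps.D1WardSolvableColourSet

end
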